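import Summits.KontsevichZagierPeriods.KontsevichZagierPeriods.Theses.StandardParts
import Literature.NumberTheory.Transcendental.KZTameMoveFamily
import Summits.KontsevichZagierPeriods.KontsevichZagierPeriods.Theses.InequalityCost
import Literature.NumberTheory.Transcendental.KZLogCalculusProofs

/-!
# Crux workfile — `stub_rawArcClosure` (line `registered` of `SpArcLifting`, item 3155) DOMINATES
# `InequalityCost.TameCovLimit` (item 8987) and `InequalityCost.TameNLLimit` (item 8989)

Kernel-checked certificate of the wave-1 worker's `stub-blocked` finding on the stub `stub_rawArcClosure`
of the line `registered` (`Cruxes/SpArcLifting/Lines/birth.lean`): the statement of the stub (closedness of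
KZ-equivalence at `L¹`-endpoints of RAW `ℚ`-semialgebraic arcs of identities, equivalence asked only at
rational parameters, no tameness) IMPLIES the rank-2 crux `TameCovLimit` of route InequalityCost (tame
closure for rule 2), whose own 3-stub line is open, and likewise the rank-4 crux `TameNLLimit` (tame closure for rule 3,
`tameNLLimit_of_rawArcClosure`). Hence `stub_rawArcClosure` is at least crux-sized.

Proof: the data `(S, G)`, `(S', G')`, `Φ` of `TameCovLimit` are a raw change-of-variables family
`KZ.RawCovFamilyOn (Ioo 0 1) n` (`KZTameMoveFamily.lean`); tameness (`S ⊆ [-N,N]ⁿ⁺¹`, `|G| ≤ N`) makes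
every fibre integrable (`integrableOn_fibre_of_isTame`: bounded measurable data on a bounded Borel fibre);
at a rational parameter `q` the fibre map `φ_q` is `ℚ`-semialgebraic
(`RawCovFamilyOn.isSemialgebraicMapOn_fibreMap`), so any realisations `ρ`, `ρ'` of the two fibres satisfy
`[ρ] − [ρ'] ∈ KZ.changeOfVariablesRel` (`RawCovFamilyOn.mem_changeOfVariablesRel`), i.e. the two raw
families form an arc of identities; the `L¹`-endpoint clauses are `KZ.RawFamily.HasL1Limit` verbatim.

Written by the lead of line `registered` (unit line-stmt-KontsevichZagierPeriods-3155-c1) as evidence for the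
planners of routes StandardParts / InequalityCost; not a Theorems file (it proves no registered stub).
-/

noncomputable section

namespace Summit.KontsevichZagierPeriods.StandardParts

open Filter Set MeasureTheory Topology
open Literature.NumberTheory.Transcendental
open Literature.ModelTheory.ExponentialFields (IsSemialgebraic)
open Summit.KontsevichZagierPeriods.KontsevichZagierPeriods.Theses.InequalityCost (TameCovLimit TameNLLimit)

variable {n : ℕ}

private theorem measurableSet_rawFamily_fibre (S : KZ.RawFamily n) (t : ℝ) : MeasurableSet (S.fibre t) := by
  have hS : MeasurableSet S.total :=
    Literature.ModelTheory.ExponentialFields.IsSemialgebraic.measurableSet_holds S.isSemialgebraic_total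
  have hc : Continuous fun x : Fin n → ℝ => (Fin.snoc x t : Fin (n + 1) → ℝ) :=
    Continuous.finSnoc (A := fun _ : Fin (n + 1) => ℝ) continuous_id continuous_const
  exact hc.measurable hS

/-- The fibre integrand of a raw family is measurable on each fibre (restriction of the measurable
function `G|_S` along the measurable map `x ↦ (x, t)`). [folklore] -/
theorem measurable_restrict_fibreFun (S : KZ.RawFamily n) (t : ℝ) :
    Measurable ((S.fibre t).restrict (S.fibreFun t)) := by
  have hG : Measurable (S.total.restrict S.integrand) :=
    IsSemialgebraicFunOn.measurable_holds S.isSemialgebraicFunOn_integrand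
  have hsnoc : Measurable fun x : Fin n → ℝ => (Fin.snoc x t : Fin (n + 1) → ℝ) :=
    (Continuous.finSnoc (A := fun _ : Fin (n + 1) => ℝ) continuous_id continuous_const).measurable
  have h : (S.fibre t).restrict (S.fibreFun t) =
      (S.total.restrict S.integrand) ∘
        (fun x : S.fibre t => (⟨Fin.snoc (x : Fin n → ℝ) t, x.2⟩ : S.total)) := by
    ext x
    rfl
  rw [h]
  exact hG.comp ((hsnoc.comp measurable_subtype_coe).subtype_mk)

/-- **Tame raw families have integrable fibres**: if `S ⊆ [-N,N]ⁿ⁺¹` and `|G| ≤ N` on `S`, then every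
fibre integrand `G_t` is integrable on the fibre `S_t` (bounded measurable function on a bounded Borel
set). [folklore] -/
theorem integrableOn_fibre_of_isTame (S : KZ.RawFamily n) {N : ℕ} (hS : S.IsTame N) (t : ℝ) :
    IntegrableOn (S.fibreFun t) (S.fibre t) := by
  have hmf : MeasurableSet (S.fibre t) := measurableSet_rawFamily_fibre S t
  have hae : AEStronglyMeasurable (S.fibreFun t) (volume.restrict (S.fibre t)) :=
    (aemeasurable_restrict_of_measurable_subtype hmf (measurable_restrict_fibreFun S t)).aestronglyMeasurable
  have hsub : S.fibre t ⊆ Set.Icc (fun _ => -(N:ℝ)) (fun _ => (N:ℝ)) := by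
    intro x hx
    have hb := (hS _ hx).1
    rw [Set.mem_Icc]
    constructor
    · intro i
      have h := abs_le.1 (hb (Fin.castSucc i))
      simpa only [Fin.snoc_castSucc] using h.1
    · intro i
      have h := abs_le.1 (hb (Fin.castSucc i))
      simpa only [Fin.snoc_castSucc] using h.2
  have hfin : volume (S.fibre t) < ⊤ :=
    (measure_mono hsub).trans_lt isCompact_Icc.measure_lt_top
  haveI : IsFiniteMeasure (volume.restrict (S.fibre t)) := isFiniteMeasure_restrict.2 hfin.ne
  refine ⟨hae, HasFiniteIntegral.of_bounded (C := (N:ℝ)) ?_⟩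
  rw [ae_restrict_iff' hmf]
  exact Eventually.of_forall fun x hx => by
    simpa only [Real.norm_eq_abs, KZ.RawFamily.fibreFun_apply] using (hS _ hx).2

/-- **`stub_rawArcClosure` dominates `TameCovLimit`.** The statement of the stub `stub_rawArcClosure` of
line `registered` (closedness of KZ-equivalence at `L¹`-endpoints of raw arcs of identities; hypothesis
written verbatim) implies the crux `TameCovLimit` of route InequalityCost (item
stmt-KontsevichZagierPeriods-8987): the tame change-of-variables data form a `KZ.RawCovFamilyOn (Ioo 0 1) n`
whose source and target are raw families with integrable fibres (`integrableOn_fibre_of_isTame`) forming an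
arc of identities (`RawCovFamilyOn.mem_changeOfVariablesRel` at rational parameters, where the fibre map is
`ℚ`-semialgebraic by `isSemialgebraicMapOn_fibreMap`). [cite: KontsevichZagier2001, §1.2 rule (2)] -/
theorem tameCovLimit_of_rawArcClosure
    (h₁ : ∀ ⦃n m : ℕ⦄ (S : KZ.RawFamily n) (S' : KZ.RawFamily m)
      (r₀ : KZ.IntegralRep n) (r₀' : KZ.IntegralRep m),
      (∀ t ∈ Set.Ioo (0:ℝ) 1, IntegrableOn (S.fibreFun t) (S.fibre t)) →
      (∀ t ∈ Set.Ioo (0:ℝ) 1, IntegrableOn (S'.fibreFun t) (S'.fibre t)) →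
      (∀ q : ℚ, (q : ℝ) ∈ Set.Ioo (0:ℝ) 1 → ∀ (ρ : KZ.IntegralRep n) (ρ' : KZ.IntegralRep m),
        ρ.domain = S.fibre q → Set.EqOn ρ.integrand (S.fibreFun q) (S.fibre q) →
        ρ'.domain = S'.fibre q → Set.EqOn ρ'.integrand (S'.fibreFun q) (S'.fibre q) →
        KZ.Equivalent ρ ρ') →
      S.HasL1Limit r₀ → S'.HasL1Limit r₀' → KZ.Equivalent r₀ r₀') :
    TameCovLimit := by
  intro n N S S' G G' Φ r₀ r₀' hS hG hS' hG' hΦ hT hT' hcov hl hl'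
  let F : KZ.RawFamily n := ⟨S, G, hS, hG⟩
  let F' : KZ.RawFamily n := ⟨S', G', hS', hG'⟩
  have hFt : F.IsTame N := hT
  have hF't : F'.IsTame N := hT'
  let M : KZ.RawCovFamilyOn (Set.Ioo (0:ℝ) 1) n :=
    { source := F
      target := F'
      map := Φ
      isSemialgebraicMapOn_map := hΦ
      injOn := fun t ht => (hcov t ht).1
      image_eq := fun t ht => (hcov t ht).2.1
      hasFDerivWithinAt := fun t ht x hx => (hcov t ht).2.2 x hx }
  refine h₁ F F' r₀ r₀' (fun t _ => integrableOn_fibre_of_isTame F hFt t)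
    (fun t _ => integrableOn_fibre_of_isTame F' hF't t) ?_ hl hl'
  intro q hq ρ ρ' hρd hρf hρ'd hρ'f
  have hmem := M.mem_changeOfVariablesRel hq ρ ρ' hρd hρ'd (by rw [hρd]; exact hρf)
    (by rw [hρ'd]; exact hρ'f) (by rw [hρd]; exact M.isSemialgebraicMapOn_fibreMap q)
  exact KZ.changeOfVariablesRel_subset_relations hmem

/-- **`stub_rawArcClosure` dominates `TameNLLimit`.** The statement of the stub `stub_rawArcClosure` also
implies the crux `TameNLLimit` of route InequalityCost (item stmt-KontsevichZagierPeriods-8989, tame closure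
for rule 3): the tame Newton–Leibniz data `(B, G)`, `(T, H)`, `F`, `a ≤ b` form a
`KZ.RawNLFamilyOn (Ioo 0 1) n` whose band and base are raw families with integrable fibres
(`integrableOn_fibre_of_isTame`) forming an arc of identities in dimensions `n + 1`, `n`
(`RawNLFamilyOn.mem_newtonLeibnizRel` at rational parameters, where the fibre primitive and band bounds
are `ℚ`-semialgebraic by `RawFamily.isSemialgebraicFunOn_fibre_of_rat`).
[cite: KontsevichZagier2001, §1.2 rule (3)] -/
theorem tameNLLimit_of_rawArcClosure
    (h₁ : ∀ ⦃n m : ℕ⦄ (S : KZ.RawFamily n) (S' : KZ.RawFamily m)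
      (r₀ : KZ.IntegralRep n) (r₀' : KZ.IntegralRep m),
      (∀ t ∈ Set.Ioo (0:ℝ) 1, IntegrableOn (S.fibreFun t) (S.fibre t)) →
      (∀ t ∈ Set.Ioo (0:ℝ) 1, IntegrableOn (S'.fibreFun t) (S'.fibre t)) →
      (∀ q : ℚ, (q : ℝ) ∈ Set.Ioo (0:ℝ) 1 → ∀ (ρ : KZ.IntegralRep n) (ρ' : KZ.IntegralRep m),
        ρ.domain = S.fibre q → Set.EqOn ρ.integrand (S.fibreFun q) (S.fibre q) →
        ρ'.domain = S'.fibre q → Set.EqOn ρ'.integrand (S'.fibreFun q) (S'.fibre q) →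
        KZ.Equivalent ρ ρ') →
      S.HasL1Limit r₀ → S'.HasL1Limit r₀' → KZ.Equivalent r₀ r₀') :
    TameNLLimit := by
  intro n N B T G F H a b r₀ r₀' hB hT hG hF hH ha hb htB htT hnl hl hl'
  let Fb : KZ.RawFamily (n + 1) := ⟨B, G, hB, hG⟩
  let Fs : KZ.RawFamily n := ⟨T, H, hT, hH⟩
  have hFbt : Fb.IsTame N := fun z hz => ⟨(htB z hz).1, (htB z hz).2.1⟩
  have hFst : Fs.IsTame N := htT
  let M : KZ.RawNLFamilyOn (Set.Ioo (0:ℝ) 1) n :=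
    { band := Fb
      base := Fs
      prim := F
      lower := a
      upper := b
      isSemialgebraicFunOn_prim := hF
      isSemialgebraicFunOn_lower := ha
      isSemialgebraicFunOn_upper := hb
      lower_le_upper := fun t ht x hx => (hnl t ht).1 x hx
      fibre_band := fun t ht => (hnl t ht).2.1
      continuousOn := fun t ht x hx => (hnl t ht).2.2.1 x hx
      hasDerivAt := fun t ht x hx s hs => (hnl t ht).2.2.2.1 x hx s hs
      base_eq := fun t ht x hx => (hnl t ht).2.2.2.2 x hx }
  refine h₁ Fb Fs r₀ r₀' (fun t _ => integrableOn_fibre_of_isTame Fb hFbt t)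
    (fun t _ => integrableOn_fibre_of_isTame Fs hFst t) ?_ hl hl'
  intro q hq ρ ρ' hρd hρf hρ'd hρ'f
  have hmem := M.mem_newtonLeibnizRel hq ρ ρ' hρd hρ'd (by rw [hρd]; exact hρf)
    (by rw [hρ'd]; exact hρ'f)
    (by rw [hρd]; exact M.band.isSemialgebraicFunOn_fibre_of_rat M.isSemialgebraicFunOn_prim q)
    (by rw [hρ'd]; exact M.base.isSemialgebraicFunOn_fibre_of_rat M.isSemialgebraicFunOn_lower q)
    (by rw [hρ'd]; exact M.base.isSemialgebraicFunOn_fibre_of_rat M.isSemialgebraicFunOn_upper q)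
  exact KZ.newtonLeibnizRel_subset_relations hmem

end Summit.KontsevichZagierPeriods.StandardParts
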